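import Literature.MathematicalPhysics.QuantumFieldTheory.Balaban1983to89.T4BetaFlowWellPosed

/-!
# EriceRemainderEnclosureHistoryAutonomyComparisonInvCubeConvex — (E70a) THE INVERSE CUBE OF THE COUPLING IS CONVEX IN THE SCALE:
# along EVERY box solution `h` of an affine memory `B(u) = b + Σ_{k<K} L_k·u_k` (`b ≥ 0`, `L ≥ 0`, Markov weight `L_0` included) the sequence
# `m ↦ 1∕h(m)³` has NON-DECREASING increments; hence the LEVEL EXPONENT SANDWICH `(2∕3)·(1∕h_m³ − 1∕h_0³)·h_{m+1} ≤ m·(1∕h_{m+1}² − 1∕h_m²) ≤ 1∕h_m² − 1∕h_0²`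
# and the secant bound `(j+k)∕h_j³ ≤ j∕h_{j+k}³ + k∕h_0³` — the convex companions of (E58b)'s concavity of the levels `1∕h²`

Cell `pub-balaban`, β-function sub-cell, BINDER row D4 «RemainderConst leaves for Bałaban's split» (`HOME/BINDER-OWNERS.md`; owner lineage `b2b-balaban-beta-an4`;
this file by co-owner #2 lineage `b2b-balaban-beta-d4-p2`, generation 60), β-FLOW TEAM duty (1), FREEZE (0) honoured (def-free; only `MemFlow` ∕ `SeqBox` of the
Literature module `T4BetaFlowWellPosed` ∕ `T4BetaStationary` BY NAME; nothing restated).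

HONEST FRAMING (page 1, verbatim and binding).  *"Discharging BetaPertH makes Bałaban's UV stability UNCONDITIONAL — a real constructive-QFT result; it is
NOT the continuum limit and NOT the Clay problem."*  THIS FILE DISCHARGES NOTHING OF THE KIND.  Elementary real analysis about ABSTRACT affine functionals on
positive sequences — hypotheses of a census, not facts; the form, signs, ages and moments of Bałaban's (1.22) limit functional are NOT PRINTED ([I] p. 298;
GAPS G-t4-U2-1∕-2) and NOT asserted.  Row D4 class UNCHANGED (critical-path width 0; instance 0∕1; D4 DISCHARGE NO DATE).  HONEST DEPENDENCY: continuum YM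
on T⁴ ⇐ BetaPertH ∧ nine spine estimates (0/9 proved); BetaPertH ⇐ (D1) ∧ (D4) ∧ CAP+tail; G-an2-4 gates asym, D1 and NE2/3/4.

THE POINT (census sense (α); the COMPARISON column, conjecture (E58′)).  (E58b) `…ComparisonAffineProfile.mul_invSq_add_le` recorded that the LEVELS
`a_m = 1∕h_m²` of an isotone memory are CONCAVE in the scale (increments non-increasing), whence the reads `h_{j+k} ≥ √(j∕(j+k))·h_j` and the window load
budget of (E65a).  For an AFFINE memory with non-negative weights the opposite-side statement also holds: `F_m = a_m^{3∕2} = 1∕h_m³` is CONVEX.  Writing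
`p_m = 1∕h_m`, `F_{m+1} − F_m = (p_{m+1}² − p_m²)·ψ(p_m, p_{m+1})` with `ψ(x,y) = (x²+xy+y²)∕(x+y)` non-decreasing in each argument; the increment
`p_{m+1}² − p_m² = b + Σ_k L_k∕p_{m+1+k}` is compared with the next one TERM BY TERM: the floor term by monotonicity of `ψ`, the age-`k` term by the
three-point inequality `ψ(P,Q)·R ≤ ψ(Q,R)·Q` (for `P² + R² ≤ 2Q²`, i.e. concavity of `p²`; proof: `Q³(P+Q) − P²R(Q+R) ≥ ½(Q−P)²(3P²+6PQ+2Q²)` by two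
AM–GM steps) transported from lag `0` to lag `k` by the log-concavity `p_{n+2}·p_n ≤ p_{n+1}²`.  CONSEQUENCES: the local growth exponent
`θ_m = m·(a_{m+1} − a_m)∕a_m` of the levels lies in `[2∕3, 1]` up to the pin correction (concavity gives `≤ 1`, convexity of `a^{3∕2}` gives `≥ 2∕3`):
the window budget's `√(j∕(j+k))` transport is the `θ = 1` extreme, while memory-dominated stretches sit at `θ = 2∕3`, where young reads do NOT decay relative
to the level (numerics `HOME/b2b-balaban-beta-d4-p2/g60/e70/README.md`: realized uniform loads on ratio-2 towers `0.111 ∕ 0.079 ∕ 0.064` at heights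
`6 ∕ 9 ∕ 12`, against the window budget's `0.098`; LP value flat `≈ 0.55`).  NOT CLAIMED: any comparison theorem; anything printed.

WHAT IS PROVED ([folklore]; 0 `def`, 0 sorry).  §1 `three_point`, `psi_mono_left`, `psi_mono_right`, `cube_sub_cube_eq`.  §2 (abstract positive
sequences `p` with `p_{m+1}² − p_m² = b + Σ_{k<K} L_k∕p_{m+1+k}`): `sq_incr_nonneg`, `mono_of_pflow`, `sq_incr_anti`, `log_concave`, `ratio_transport`,
**`cube_incr_mono`** (convexity), `cube_incr_mono_of_le`, **`cube_secant`** (`(j+k)·p_j³ ≤ j·p_{j+k}³ + k·p_0³`), **`exponent_sandwich`**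
(`(2∕3)(p_m³ − p_0³) ≤ m·(p_{m+1}² − p_m²)·p_{m+1}` and `m·(p_{m+1}² − p_m²) ≤ p_m² − p_0²`).  §3 (box solutions of `MemFlow`): **`inv_cube_convex`**,
**`inv_cube_secant`**, **`level_exponent_ge_two_thirds`**.
-/
noncomputable section
open Finset Set

namespace Summit.QuantumFields.BalabanUV.Beta.EriceRemainderEnclosureHistoryAutonomyComparisonInvCubeConvex

open Literature.MathematicalPhysics.QuantumFieldTheory.Balaban1983to89
open Literature.MathematicalPhysics.QuantumFieldTheory.Balaban1983to89.T4BetaStationary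
open Literature.MathematicalPhysics.QuantumFieldTheory.Balaban1983to89.T4BetaFlowWellPosed

variable {b : ℝ} {L : ℕ → ℝ} {K : ℕ} {p h : ℕ → ℝ} {γ y : ℝ}

/-! ## §1 Three real inequalities -/

/-- **THE THREE-POINT INEQUALITY.**  For `P, Q ≥ 0` and real `R` with `P² + R² ≤ 2Q²` (the middle square at least the mean of the outer squares):
`(P²+PQ+Q²)·R·(Q+R) ≤ (Q²+QR+R²)·Q·(P+Q)`, i.e. `ψ(P,Q)·R ≤ ψ(Q,R)·Q` for `ψ(x,y) = (x²+xy+y²)∕(x+y)`.  Proof: the difference is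
`Q³(P+Q) − P²R(Q+R)`; `R(Q+R) ≤ (R²+Q²)∕2 + R² ≤ (7Q² − 3P²)∕2` and `2Q⁴ + 2PQ³ − 7P²Q² + 3P⁴ = (Q−P)²(3P² + 6PQ + 2Q²)`. [folklore] -/
theorem three_point {P Q R : ℝ} (hP : 0 ≤ P) (hQ : 0 ≤ Q) (hmid : P ^ 2 + R ^ 2 ≤ 2 * Q ^ 2) :
    (P ^ 2 + P * Q + Q ^ 2) * (R * (Q + R)) ≤ (Q ^ 2 + Q * R + R ^ 2) * (Q * (P + Q)) := by
  have h1 : 0 ≤ P ^ 2 * (2 * Q ^ 2 - P ^ 2 - R ^ 2) := mul_nonneg (sq_nonneg P) (by linarith)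
  have h2 : 0 ≤ P ^ 2 * (R - Q) ^ 2 := mul_nonneg (sq_nonneg P) (sq_nonneg _)
  have h3 : 0 ≤ (Q - P) ^ 2 * (3 * P ^ 2 + 6 * P * Q + 2 * Q ^ 2) :=
    mul_nonneg (sq_nonneg _) (by positivity)
  nlinarith [h1, h2, h3]

/-- `ψ(x,y) = (x²+xy+y²)∕(x+y)` is non-decreasing in its first argument on the positive quadrant (cross-multiplied form):
`x ≤ x′` ⟹ `(x²+xy+y²)(x′+y) ≤ (x′²+x′y+y²)(x+y)`. [folklore] -/
theorem psi_mono_left {x x' y : ℝ} (hx : 0 ≤ x) (hxx' : x ≤ x') (hy : 0 ≤ y) :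
    (x ^ 2 + x * y + y ^ 2) * (x' + y) ≤ (x' ^ 2 + x' * y + y ^ 2) * (x + y) := by
  have hx' : 0 ≤ x' := hx.trans hxx'
  have h1 : 0 ≤ (x' - x) * (x * x' + x * y + x' * y) := mul_nonneg (by linarith) (by positivity)
  nlinarith [h1]

/-- `ψ` is non-decreasing in its second argument (cross-multiplied form): `y ≤ y′` ⟹ `(x²+xy+y²)(x+y′) ≤ (x²+xy′+y′²)(x+y)`. [folklore] -/
theorem psi_mono_right {x y y' : ℝ} (hx : 0 ≤ x) (hy : 0 ≤ y) (hyy' : y ≤ y') :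
    (x ^ 2 + x * y + y ^ 2) * (x + y') ≤ (x ^ 2 + x * y' + y' ^ 2) * (x + y) := by
  have hy' : 0 ≤ y' := hy.trans hyy'
  have h1 : 0 ≤ (y' - y) * (y * y' + x * y + x * y') := mul_nonneg (by linarith) (by positivity)
  nlinarith [h1]

/-- The factorisation of a difference of cubes through the difference of squares: `(y³ − x³)(x + y) = (y² − x²)(x² + xy + y²)`. [folklore] -/
theorem cube_sub_cube_eq (x y : ℝ) : (y ^ 3 - x ^ 3) * (x + y) = (y ^ 2 - x ^ 2) * (x ^ 2 + x * y + y ^ 2) := by ring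

/-! ## §2 Positive sequences driven by an affine memory: `p_{m+1}² − p_m² = b + Σ_{k<K} L_k ∕ p_{m+1+k}` -/

/-- The square increments are non-negative (`b ≥ 0`, `L ≥ 0`, `p > 0`). [folklore] -/
theorem sq_incr_nonneg (hb : 0 ≤ b) (hL : ∀ k, 0 ≤ L k) (hp : ∀ j, 0 < p j)
    (hflow : ∀ m, p (m + 1) ^ 2 - p m ^ 2 = b + ∑ k ∈ range K, L k / p (m + 1 + k)) (m : ℕ) :
    0 ≤ p (m + 1) ^ 2 - p m ^ 2 := by
  rw [hflow m]
  exact add_nonneg hb (sum_nonneg fun k _ => div_nonneg (hL k) (hp _).le)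

/-- The sequence is non-decreasing. [folklore] -/
theorem mono_of_pflow (hb : 0 ≤ b) (hL : ∀ k, 0 ≤ L k) (hp : ∀ j, 0 < p j)
    (hflow : ∀ m, p (m + 1) ^ 2 - p m ^ 2 = b + ∑ k ∈ range K, L k / p (m + 1 + k)) : Monotone p := by
  refine monotone_nat_of_le_succ fun m => ?_
  have h := sq_incr_nonneg hb hL hp hflow m
  exact (pow_le_pow_iff_left₀ (hp m).le (hp (m + 1)).le two_ne_zero).mp (by linarith)

/-- The square increments are non-increasing in the scale (each read `L_k∕p_{m+1+k}` decreases as `p` increases) — concavity of the levels `p²`. [folklore] -/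
theorem sq_incr_anti (hb : 0 ≤ b) (hL : ∀ k, 0 ≤ L k) (hp : ∀ j, 0 < p j)
    (hflow : ∀ m, p (m + 1) ^ 2 - p m ^ 2 = b + ∑ k ∈ range K, L k / p (m + 1 + k)) {m m' : ℕ} (hmm' : m ≤ m') :
    p (m' + 1) ^ 2 - p m' ^ 2 ≤ p (m + 1) ^ 2 - p m ^ 2 := by
  have hmono := mono_of_pflow hb hL hp hflow
  rw [hflow m, hflow m']
  have hs : ∑ k ∈ range K, L k / p (m' + 1 + k) ≤ ∑ k ∈ range K, L k / p (m + 1 + k) :=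
    sum_le_sum fun k _ => div_le_div_of_nonneg_left (hL k) (hp _) (hmono (by omega))
  linarith

/-- **LOG-CONCAVITY**: `p_{n+2}·p_n ≤ p_{n+1}²` (from `p_{n+2}² ≤ 2p_{n+1}² − p_n²` and `(p_{n+1}² − p_n²)² ≥ 0`). [folklore] -/
theorem log_concave (hb : 0 ≤ b) (hL : ∀ k, 0 ≤ L k) (hp : ∀ j, 0 < p j)
    (hflow : ∀ m, p (m + 1) ^ 2 - p m ^ 2 = b + ∑ k ∈ range K, L k / p (m + 1 + k)) (n : ℕ) :
    p (n + 2) * p n ≤ p (n + 1) ^ 2 := by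
  have hanti := sq_incr_anti hb hL hp hflow (Nat.le_succ n)
  have h0 := (hp n).le; have h1 := (hp (n + 1)).le; have h2 := (hp (n + 2)).le
  -- squares: (p(n+2) p n)² ≤ (2p(n+1)² − p n²)·p n² ≤ p(n+1)⁴
  have hsq : (p (n + 2) * p n) ^ 2 ≤ (p (n + 1) ^ 2) ^ 2 := by
    have e1 : p (n + 2) ^ 2 ≤ 2 * p (n + 1) ^ 2 - p n ^ 2 := by
      have : p (n + 1 + 1) = p (n + 2) := rfl
      linarith
    nlinarith [mul_le_mul_of_nonneg_right e1 (sq_nonneg (p n)), sq_nonneg (p (n + 1) ^ 2 - p n ^ 2)]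
  exact (pow_le_pow_iff_left₀ (mul_nonneg h2 h0) (pow_nonneg h1 2) two_ne_zero).mp hsq

/-- Ratio transport: `p_{m+2+k}·p_{m+1} ≤ p_{m+2}·p_{m+1+k}` for every lag `k` (the ratios `p_{n+1}∕p_n` are non-increasing). [folklore] -/
theorem ratio_transport (hb : 0 ≤ b) (hL : ∀ k, 0 ≤ L k) (hp : ∀ j, 0 < p j)
    (hflow : ∀ m, p (m + 1) ^ 2 - p m ^ 2 = b + ∑ k ∈ range K, L k / p (m + 1 + k)) (m k : ℕ) :
    p (m + 2 + k) * p (m + 1) ≤ p (m + 2) * p (m + 1 + k) := by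
  induction k with
  | zero => simp [mul_comm]
  | succ k ih =>
    have hlc := log_concave hb hL hp hflow (m + 1 + k)
    have e1 : p (m + 1 + k + 2) = p (m + 2 + (k + 1)) := by ring_nf
    have e2 : p (m + 1 + k + 1) = p (m + 2 + k) := by ring_nf
    rw [e1, e2] at hlc
    have hA := hp (m + 2 + k); have hB := hp (m + 1 + k)
    -- multiply: p(m+3+k) p(m+1+k) · p(m+2+k) p(m+1) ≤ p(m+2+k)² · p(m+2) p(m+1+k), then cancel p(m+1+k)·p(m+2+k) > 0
    have hprod := mul_le_mul hlc ih (mul_nonneg hA.le (hp (m + 1)).le) (pow_nonneg (hp (m + 2 + k)).le 2)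
    have e3 : p (m + 1 + (k + 1)) = p (m + 2 + k) := by ring_nf
    rw [e3]
    have key : (p (m + 2 + (k + 1)) * p (m + 1)) * (p (m + 1 + k) * p (m + 2 + k)) ≤
        (p (m + 2) * p (m + 2 + k)) * (p (m + 1 + k) * p (m + 2 + k)) := by
      calc (p (m + 2 + (k + 1)) * p (m + 1)) * (p (m + 1 + k) * p (m + 2 + k))
          = p (m + 2 + (k + 1)) * p (m + 1 + k) * (p (m + 2 + k) * p (m + 1)) := by ring
        _ ≤ p (m + 2 + k) ^ 2 * (p (m + 2) * p (m + 1 + k)) := hprod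
        _ = (p (m + 2) * p (m + 2 + k)) * (p (m + 1 + k) * p (m + 2 + k)) := by ring
    exact le_of_mul_le_mul_right key (mul_pos hB hA)

/-- **CONVEXITY OF THE CUBES.**  Along a positive sequence with `p_{m+1}² − p_m² = b + Σ_{k<K} L_k∕p_{m+1+k}` (`b ≥ 0`, `L ≥ 0`), the increments of `p³`
are non-decreasing: `p_{m+1}³ − p_m³ ≤ p_{m+2}³ − p_{m+1}³`.  Term by term: floor by `psi_mono`, age `k` by `three_point` ∘ `ratio_transport`. [folklore] -/
theorem cube_incr_mono (hb : 0 ≤ b) (hL : ∀ k, 0 ≤ L k) (hp : ∀ j, 0 < p j)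
    (hflow : ∀ m, p (m + 1) ^ 2 - p m ^ 2 = b + ∑ k ∈ range K, L k / p (m + 1 + k)) (m : ℕ) :
    p (m + 1) ^ 3 - p m ^ 3 ≤ p (m + 2) ^ 3 - p (m + 1) ^ 3 := by
  have hmono := mono_of_pflow hb hL hp hflow
  set P := p m with hP_def
  set Q := p (m + 1) with hQ_def
  set R := p (m + 2) with hR_def
  have hP := hp m; have hQ := hp (m + 1); have hR := hp (m + 2)
  rw [← hP_def] at hP; rw [← hQ_def] at hQ; rw [← hR_def] at hR
  have hPQ : P ≤ Q := hmono (Nat.le_succ m)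
  have hQR : Q ≤ R := hmono (Nat.le_succ (m + 1))
  -- the ψ factors (cross-multiplied): ψ_m = (P²+PQ+Q²)/(P+Q), ψ_{m+1} = (Q²+QR+R²)/(Q+R)
  have hψ : (P ^ 2 + P * Q + Q ^ 2) / (P + Q) ≤ (Q ^ 2 + Q * R + R ^ 2) / (Q + R) := by
    have hψ1 : (P ^ 2 + P * Q + Q ^ 2) / (P + Q) ≤ (Q ^ 2 + Q * Q + Q ^ 2) / (Q + Q) := by
      rw [div_le_div_iff₀ (by positivity) (by positivity)]
      exact psi_mono_left hP.le hPQ hQ.le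
    have hψ2 : (Q ^ 2 + Q * Q + Q ^ 2) / (Q + Q) ≤ (Q ^ 2 + Q * R + R ^ 2) / (Q + R) := by
      rw [div_le_div_iff₀ (by positivity) (by positivity)]
      exact psi_mono_right hQ.le hQ.le hQR
    exact hψ1.trans hψ2
  -- the increment identity p³-differences = (p²-differences) · ψ
  have hincm : Q ^ 3 - P ^ 3 = (Q ^ 2 - P ^ 2) * ((P ^ 2 + P * Q + Q ^ 2) / (P + Q)) := by
    field_simp
    ring
  have hincm1 : R ^ 3 - Q ^ 3 = (R ^ 2 - Q ^ 2) * ((Q ^ 2 + Q * R + R ^ 2) / (Q + R)) := by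
    field_simp
    ring
  -- the square increments, expanded
  have hfm : Q ^ 2 - P ^ 2 = b + ∑ k ∈ range K, L k / p (m + 1 + k) := hflow m
  have hfm1 : R ^ 2 - Q ^ 2 = b + ∑ k ∈ range K, L k / p (m + 2 + k) := by
    have := hflow (m + 1)
    simpa [add_assoc, show (1 : ℕ) + 1 = 2 from rfl, add_comm, add_left_comm] using this
  -- concavity of p²: P² + R² ≤ 2Q²
  have hmid : P ^ 2 + R ^ 2 ≤ 2 * Q ^ 2 := by
    have := sq_incr_anti hb hL hp hflow (Nat.le_succ m)
    simp only [← hQ_def, ← hP_def] at this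
    have e : p (m + 1 + 1) = R := rfl
    rw [e] at this
    linarith
  -- three-point at lag 0, transported to lag k
  have h3 := three_point hP.le hQ.le hmid
  have hterm : ∀ k ∈ range K, L k / p (m + 1 + k) * ((P ^ 2 + P * Q + Q ^ 2) / (P + Q)) ≤
      L k / p (m + 2 + k) * ((Q ^ 2 + Q * R + R ^ 2) / (Q + R)) := by
    intro k _
    have hA := hp (m + 1 + k); have hB := hp (m + 2 + k)
    have hrt := ratio_transport hb hL hp hflow m k
    simp only [← hQ_def, ← hR_def] at hrt
    -- ψ_m · p(m+2+k) ≤ ψ_{m+1} · p(m+1+k)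
    have hkey : (P ^ 2 + P * Q + Q ^ 2) / (P + Q) * p (m + 2 + k) ≤ (Q ^ 2 + Q * R + R ^ 2) / (Q + R) * p (m + 1 + k) := by
      rw [div_mul_eq_mul_div, div_mul_eq_mul_div, div_le_div_iff₀ (by positivity) (by positivity)]
      -- (P²+PQ+Q²) p(m+2+k) (Q+R) ≤ (Q²+QR+R²) p(m+1+k) (P+Q)
      -- from h3: (P²+PQ+Q²) R (Q+R) ≤ (Q²+QR+R²) Q (P+Q) and hrt: p(m+2+k) Q ≤ R p(m+1+k)
      have e1 : (P ^ 2 + P * Q + Q ^ 2) * p (m + 2 + k) * (Q + R) * Q ≤ (P ^ 2 + P * Q + Q ^ 2) * (R * (Q + R)) * p (m + 1 + k) := by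
        have := mul_le_mul_of_nonneg_left hrt (by positivity : 0 ≤ (P ^ 2 + P * Q + Q ^ 2) * (Q + R))
        nlinarith [this]
      have e2 : (P ^ 2 + P * Q + Q ^ 2) * (R * (Q + R)) * p (m + 1 + k) ≤ (Q ^ 2 + Q * R + R ^ 2) * (Q * (P + Q)) * p (m + 1 + k) :=
        mul_le_mul_of_nonneg_right h3 hA.le
      have e3 : (P ^ 2 + P * Q + Q ^ 2) * p (m + 2 + k) * (Q + R) * Q ≤ ((Q ^ 2 + Q * R + R ^ 2) * p (m + 1 + k) * (P + Q)) * Q := by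
        nlinarith [e1, e2]
      exact le_of_mul_le_mul_right e3 hQ
    have := mul_le_mul_of_nonneg_left hkey (hL k)
    calc L k / p (m + 1 + k) * ((P ^ 2 + P * Q + Q ^ 2) / (P + Q))
        = L k * ((P ^ 2 + P * Q + Q ^ 2) / (P + Q) * p (m + 2 + k)) / (p (m + 1 + k) * p (m + 2 + k)) := by
          field_simp
      _ ≤ L k * ((Q ^ 2 + Q * R + R ^ 2) / (Q + R) * p (m + 1 + k)) / (p (m + 1 + k) * p (m + 2 + k)) :=
          div_le_div_of_nonneg_right this (by positivity)
      _ = L k / p (m + 2 + k) * ((Q ^ 2 + Q * R + R ^ 2) / (Q + R)) := by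
          field_simp
  have hsum := sum_le_sum hterm
  rw [← sum_mul, ← sum_mul] at hsum
  have hfloor : b * ((P ^ 2 + P * Q + Q ^ 2) / (P + Q)) ≤ b * ((Q ^ 2 + Q * R + R ^ 2) / (Q + R)) :=
    mul_le_mul_of_nonneg_left hψ hb
  rw [hincm, hincm1, hfm, hfm1, add_mul, add_mul]
  linarith

/-- Monotonicity of the cube increments between any two scales `m ≤ m′`. [folklore] -/
theorem cube_incr_mono_of_le (hb : 0 ≤ b) (hL : ∀ k, 0 ≤ L k) (hp : ∀ j, 0 < p j)
    (hflow : ∀ m, p (m + 1) ^ 2 - p m ^ 2 = b + ∑ k ∈ range K, L k / p (m + 1 + k)) {m m' : ℕ} (hmm' : m ≤ m') :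
    p (m + 1) ^ 3 - p m ^ 3 ≤ p (m' + 1) ^ 3 - p m' ^ 3 := by
  induction hmm' with
  | refl => exact le_rfl
  | @step m'' _ ih =>
    refine ih.trans ?_
    have := cube_incr_mono hb hL hp hflow m''
    exact this

/-- **THE SECANT BOUND** (the convex counterpart of (E58b) `mul_invSq_add_le`): `(j+k)·p_j³ ≤ j·p_{j+k}³ + k·p_0³` — the cube at scale `j` lies below the
chord from the pin to scale `j+k`. [folklore] -/
theorem cube_secant (hb : 0 ≤ b) (hL : ∀ k, 0 ≤ L k) (hp : ∀ j, 0 < p j)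
    (hflow : ∀ m, p (m + 1) ^ 2 - p m ^ 2 = b + ∑ k ∈ range K, L k / p (m + 1 + k)) (j k : ℕ) :
    ((j : ℝ) + k) * p j ^ 3 ≤ (j : ℝ) * p (j + k) ^ 3 + (k : ℝ) * p 0 ^ 3 := by
  rcases Nat.eq_zero_or_pos j with hj | hj
  · subst hj; simp
  -- telescoping
  have htel1 : ∑ i ∈ range j, (p (i + 1) ^ 3 - p i ^ 3) = p j ^ 3 - p 0 ^ 3 := sum_range_sub (fun i => p i ^ 3) j
  have htel2 : ∑ i ∈ range k, (p (j + i + 1) ^ 3 - p (j + i) ^ 3) = p (j + k) ^ 3 - p j ^ 3 := by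
    have := sum_range_sub (fun i => p (j + i) ^ 3) k
    simpa [add_assoc] using this
  -- every early increment ≤ Δ_{j-1} ≤ every late increment
  have hup : ∑ i ∈ range j, (p (i + 1) ^ 3 - p i ^ 3) ≤ (j : ℝ) * (p (j - 1 + 1) ^ 3 - p (j - 1) ^ 3) := by
    have : ∑ i ∈ range j, (p (i + 1) ^ 3 - p i ^ 3) ≤ ∑ _i ∈ range j, (p (j - 1 + 1) ^ 3 - p (j - 1) ^ 3) :=
      sum_le_sum fun i hi => cube_incr_mono_of_le hb hL hp hflow (by have := mem_range.mp hi; omega)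
    rwa [sum_const, card_range, nsmul_eq_mul] at this
  have hlow : (k : ℝ) * (p (j - 1 + 1) ^ 3 - p (j - 1) ^ 3) ≤ ∑ i ∈ range k, (p (j + i + 1) ^ 3 - p (j + i) ^ 3) := by
    have : ∑ _i ∈ range k, (p (j - 1 + 1) ^ 3 - p (j - 1) ^ 3) ≤ ∑ i ∈ range k, (p (j + i + 1) ^ 3 - p (j + i) ^ 3) :=
      sum_le_sum fun i _ => cube_incr_mono_of_le hb hL hp hflow (by omega)
    rwa [sum_const, card_range, nsmul_eq_mul] at this
  rw [htel1] at hup; rw [htel2] at hlow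
  have hk0 : (0 : ℝ) ≤ k := Nat.cast_nonneg k
  have hj0 : (0 : ℝ) ≤ j := Nat.cast_nonneg j
  -- k (F_j - F_0) ≤ k j Δ ≤ j (F_{j+k} - F_j)
  have e1 := mul_le_mul_of_nonneg_left hup hk0
  have e2 := mul_le_mul_of_nonneg_left hlow hj0
  nlinarith [e1, e2]

/-- **THE EXPONENT SANDWICH.**  Along the sequence: `(2∕3)·(p_m³ − p_0³) ≤ m·(p_{m+1}² − p_m²)·p_{m+1}` (convexity of the cubes: the sum of the first `m`
cube increments is at most `m` times the last, and `p_{m+1}³ − p_m³ ≤ (3∕2)(p_{m+1}² − p_m²)·p_{m+1}`) and `m·(p_{m+1}² − p_m²) ≤ p_m² − p_0²` (concavity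
of the squares).  With `a = p²` the level and `θ_m = m(a_{m+1} − a_m)∕a_m` its local growth exponent: `(2∕3)(1 − (a_0∕a_m)^{3∕2})·√(a_m∕a_{m+1}) ≤ θ_m ≤ 1`.
[folklore] -/
theorem exponent_sandwich (hb : 0 ≤ b) (hL : ∀ k, 0 ≤ L k) (hp : ∀ j, 0 < p j)
    (hflow : ∀ m, p (m + 1) ^ 2 - p m ^ 2 = b + ∑ k ∈ range K, L k / p (m + 1 + k)) (m : ℕ) :
    2 / 3 * (p m ^ 3 - p 0 ^ 3) ≤ (m : ℝ) * (p (m + 1) ^ 2 - p m ^ 2) * p (m + 1) ∧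
      (m : ℝ) * (p (m + 1) ^ 2 - p m ^ 2) ≤ p m ^ 2 - p 0 ^ 2 := by
  have hmono := mono_of_pflow hb hL hp hflow
  constructor
  · have htel : ∑ i ∈ range m, (p (i + 1) ^ 3 - p i ^ 3) = p m ^ 3 - p 0 ^ 3 := sum_range_sub (fun i => p i ^ 3) m
    have hup : ∑ i ∈ range m, (p (i + 1) ^ 3 - p i ^ 3) ≤ (m : ℝ) * (p (m + 1) ^ 3 - p m ^ 3) := by
      have : ∑ i ∈ range m, (p (i + 1) ^ 3 - p i ^ 3) ≤ ∑ _i ∈ range m, (p (m + 1) ^ 3 - p m ^ 3) :=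
        sum_le_sum fun i hi => cube_incr_mono_of_le hb hL hp hflow (mem_range.mp hi).le
      rwa [sum_const, card_range, nsmul_eq_mul] at this
    rw [htel] at hup
    -- Δ_m ≤ (3/2)(Q² − P²) Q
    have hP := hp m; have hQ := hp (m + 1); have hPQ : p m ≤ p (m + 1) := hmono (Nat.le_succ m)
    have hΔ : p (m + 1) ^ 3 - p m ^ 3 ≤ 3 / 2 * (p (m + 1) ^ 2 - p m ^ 2) * p (m + 1) := by
      nlinarith [mul_nonneg (mul_nonneg (sub_nonneg.2 hPQ) (sub_nonneg.2 hPQ)) (by linarith : 0 ≤ 2 * p m + p (m + 1))]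
    have hm0 : (0 : ℝ) ≤ m := Nat.cast_nonneg m
    nlinarith [mul_le_mul_of_nonneg_left hΔ hm0, hup]
  · have htel : ∑ i ∈ range m, (p (i + 1) ^ 2 - p i ^ 2) = p m ^ 2 - p 0 ^ 2 := sum_range_sub (fun i => p i ^ 2) m
    have hlow : ∑ _i ∈ range m, (p (m + 1) ^ 2 - p m ^ 2) ≤ ∑ i ∈ range m, (p (i + 1) ^ 2 - p i ^ 2) :=
      sum_le_sum fun i hi => sq_incr_anti hb hL hp hflow (mem_range.mp hi).le
    rw [sum_const, card_range, nsmul_eq_mul, htel] at hlow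
    exact hlow

/-! ## §3 Box solutions of the flow with an affine memory -/

/-- The inverse couplings `p = 1∕h` of a positive solution of `MemFlow (b + Σ_{k<K} L_k·u_k)` satisfy the §2 recursion. [folklore] -/
theorem pflow_of_memFlow (hf : MemFlow (fun u : ℕ → ℝ => b + ∑ k ∈ range K, L k * u k) y h) (m : ℕ) :
    (1 / h (m + 1)) ^ 2 - (1 / h m) ^ 2 = b + ∑ k ∈ range K, L k / (1 / h (m + 1 + k)) := by
  have e := hf.2 m
  simp only [one_div_pow]
  simp only at e
  have : ∀ k ∈ range K, L k / (1 / h (m + 1 + k)) = L k * h (m + 1 + k) := fun k _ => by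
    rw [div_eq_mul_one_div, one_div_one_div]
  rw [sum_congr rfl this]
  linarith

/-- **THE INVERSE CUBE OF THE COUPLING IS CONVEX IN THE SCALE.**  Along every positive solution `h` of the flow with the affine memory
`B(u) = b + Σ_{k<K} L_k·u_k` (`b ≥ 0`, `L ≥ 0`; Markov weight `L_0` and pin arbitrary): `1∕h_{m+1}³ − 1∕h_m³ ≤ 1∕h_{m+2}³ − 1∕h_{m+1}³` for every `m`.
[folklore] -/
theorem inv_cube_convex (hb : 0 ≤ b) (hL : ∀ k, 0 ≤ L k) (hpos : ∀ j, 0 < h j)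
    (hf : MemFlow (fun u : ℕ → ℝ => b + ∑ k ∈ range K, L k * u k) y h) (m : ℕ) :
    1 / h (m + 1) ^ 3 - 1 / h m ^ 3 ≤ 1 / h (m + 2) ^ 3 - 1 / h (m + 1) ^ 3 := by
  have hp : ∀ j, 0 < 1 / h j := fun j => one_div_pos.2 (hpos j)
  have := cube_incr_mono hb hL hp (pflow_of_memFlow hf) m
  simpa only [one_div_pow] using this

/-- **THE SECANT BOUND FOR THE INVERSE CUBES**: `(j+k)∕h_j³ ≤ j∕h_{j+k}³ + k∕h_0³` — an UPPER bound on the coupling `k` scales after `j` in terms of the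
coupling at `j` and at the pin (companion of (E58b)'s lower bound `h_{j+k} ≥ √(j∕(j+k))·h_j`). [folklore] -/
theorem inv_cube_secant (hb : 0 ≤ b) (hL : ∀ k, 0 ≤ L k) (hpos : ∀ j, 0 < h j)
    (hf : MemFlow (fun u : ℕ → ℝ => b + ∑ k ∈ range K, L k * u k) y h) (j k : ℕ) :
    ((j : ℝ) + k) * (1 / h j ^ 3) ≤ (j : ℝ) * (1 / h (j + k) ^ 3) + (k : ℝ) * (1 / h 0 ^ 3) := by
  have hp : ∀ j, 0 < 1 / h j := fun j => one_div_pos.2 (hpos j)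
  have := cube_secant hb hL hp (pflow_of_memFlow hf) j k
  simpa only [one_div_pow] using this

/-- **THE LEVEL EXPONENT IS AT LEAST TWO THIRDS** (up to the pin): `(2∕3)·(1∕h_m³ − 1∕h_0³)·h_{m+1} ≤ m·(1∕h_{m+1}² − 1∕h_m²)` along every positive
solution; (E58b)'s concavity gives the other side `m·(1∕h_{m+1}² − 1∕h_m²) ≤ 1∕h_m² − 1∕h_0²`. [folklore] -/
theorem level_exponent_ge_two_thirds (hb : 0 ≤ b) (hL : ∀ k, 0 ≤ L k) (hpos : ∀ j, 0 < h j)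
    (hf : MemFlow (fun u : ℕ → ℝ => b + ∑ k ∈ range K, L k * u k) y h) (m : ℕ) :
    2 / 3 * (1 / h m ^ 3 - 1 / h 0 ^ 3) * h (m + 1) ≤ (m : ℝ) * (1 / h (m + 1) ^ 2 - 1 / h m ^ 2) ∧
      (m : ℝ) * (1 / h (m + 1) ^ 2 - 1 / h m ^ 2) ≤ 1 / h m ^ 2 - 1 / h 0 ^ 2 := by
  have hp : ∀ j, 0 < 1 / h j := fun j => one_div_pos.2 (hpos j)
  obtain ⟨h1, h2⟩ := exponent_sandwich hb hL hp (pflow_of_memFlow hf) m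
  simp only [one_div_pow] at h1 h2
  refine ⟨?_, h2⟩
  have hq : 0 < h (m + 1) := hpos (m + 1)
  -- multiply h1 by h(m+1) > 0: (m·inc·(1/h(m+1)))·h(m+1) = m·inc
  have := mul_le_mul_of_nonneg_right h1 hq.le
  have e : (m : ℝ) * (1 / h (m + 1) ^ 2 - 1 / h m ^ 2) * (1 / h (m + 1)) * h (m + 1) =
      (m : ℝ) * (1 / h (m + 1) ^ 2 - 1 / h m ^ 2) := by
    field_simp
  linarith [this, e]

end Summit.QuantumFields.BalabanUV.Beta.EriceRemainderEnclosureHistoryAutonomyComparisonInvCubeConvex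

end
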